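import Summits.Ventures.PercRepro2.TypedCountNegative

/-!
# The typed (PS) count is NEGATIVE on `K_{2,5}` with a pendant leaf
(blind cell PercRepro2, night-3 g27, 2026-08-29; `proofs/NIGHT3-CERT.md` §36.11)

The class count `S_D = Σ_{A : v ∈ R_A xor v ∈ B_A} (f(R_A) − f(B_A))(g(R_A) − g(B_A))` — the
two-copy Bernstein coefficient of the cross form (PS) = `PointSplitBHK` (`typedCountW wXOR` of
`TypedClassPendant`) — is nonnegative on every 2-connected simple graph with `≤ 8` vertices
(kits j331865, j331952) and on every `K_{2,n}` (`K2nTypedPS`), but it is **negative** on `K_{2,5}`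
with a pendant leaf `v = 7` at the hub `1` (eight vertices, eleven edges): with `s = 0`,
`f = [{2, 6} ⊆ ·]`, `g = [{3, 4, 5} ⊆ ·]` the count is `−6 = 2·T(K_{2,5}; 0, 1; f, g)`
(`TypedCountNegative`): for a pendant split point the XOR class of the graph is twice the (PS1)
class of the graph without the leaf.  `decide +kernel` on the bitmask model, 2,048 colourings.
Own work; standard axioms.
-/

namespace Summit.Ventures.PercRepro2

namespace TypedCert

/-- The typed (PS) count in the bitmask model:
`Σ_{A < 2^m : v ∈ R_A xor v ∈ B_A} (f R_A − f B_A)(g R_A − g B_A)`. -/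
def TformXOR {R : Type*} [CommRing R] (edges : Edges) (s v : Nat) (f g : Nat → R) : R :=
  ((List.range (1 <<< edges.length)).map (fun A =>
    let Rm := clusterMask edges A s
    let Bm := clusterMask edges (flipMask edges.length A) s
    if (Rm.testBit v != Bm.testBit v) then (f Rm - f Bm) * (g Rm - g Bm) else 0)).sum

/-- `S_D(K_{2,5} + leaf 7 at hub 1; s = 0, v = 7) = −6` for `f = [{2, 6} ⊆ ·]` (mask `68`) and
`g = [{3, 4, 5} ⊆ ·]` (mask `56`). -/
theorem TformXOR_K25leaf_eq_neg_six :
    TformXOR [(0, 2), (0, 3), (0, 4), (0, 5), (0, 6), (1, 2), (1, 3), (1, 4), (1, 5), (1, 6), (1, 7)]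
      0 7 (fun X : Nat => if X &&& 68 = 68 then (1 : ℚ) else 0)
      (fun X : Nat => if X &&& 56 = 56 then (1 : ℚ) else 0) = -6 := by
  decide +kernel

/-- **The typed (PS) count can be negative**: on `K_{2,5}` with a pendant leaf at the hub there are
mask-monotone `f, g` with `S_D < 0`. -/
theorem exists_TformXOR_neg :
    ∃ f g : Nat → ℚ, MonoMask f ∧ MonoMask g ∧
      TformXOR [(0, 2), (0, 3), (0, 4), (0, 5), (0, 6), (1, 2), (1, 3), (1, 4), (1, 5), (1, 6), (1, 7)]
        0 7 f g < 0 :=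
  ⟨_, _, monoMask_indicator_subset' 68, monoMask_indicator_subset' 56, by
    rw [TformXOR_K25leaf_eq_neg_six]; norm_num⟩

end TypedCert

end Summit.Ventures.PercRepro2
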